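import Literature.Topology.FourManifolds.OneHandlebodyMirrorFour
import Literature.Topology.FourManifolds.SPC4HandlesModelReduction
import Literature.AlgebraicTopology.FundamentalGroup.SpunLoops
import HarnessLib

/-!
# SYMMᴹ: the mirror symmetry of `{q(x, y) + z² + w² ≤ c} ⊂ ℝ⁴` acts trivially on `π₁` of
# the boundary — discharge of `exists_oneHandlebody_diffeoExtends_isOrientationReversing.{0}`

Topic `Literature/Topology/FourManifolds`; fact seat
`provefact-Literature.Topology.FourManifolds.exists_diffeomorph_comp_incl_eq` (Laudenbach–Poénaru's
extension theorem).  Of the DAG `FACT ⇐ NORM + UNIQ₄ + LEMMA2ᴹ + THMAᴹ + SYMMᴹ`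
(`SPC4HandlesModelReduction.lean`) this file **proves SYMMᴹ in universe `0`**
(`Literature.Topology.FourManifolds.exists_oneHandlebody_diffeoExtends_isOrientationReversing_zero`):
*for every `k` some compact connected orientable smooth `4`-manifold with boundary with one
`0`-handle and `k` `1`-handles has a boundary datum carrying a self-diffeomorphism `ρ₀` that
extends over the body, reverses every smooth orientation of the boundary, fixes a point `z₀`
and induces the identity of `π₁(∂, z₀)`*.

The model, `ρ₀`, its extension, its orientation character and the base point are those of
`ThickenedHandlebodyFour.lean` / `OneHandlebodyMirrorFour.lean`: `Y = {q(x, y) + z² + w² ≤ c}`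
for a planar Morse function `q` presenting a disc with `k` holes, the restriction `ρ₀` of the
reflection `w ↦ -w`, and `z₀ = (u₀, 0, 0)` with `q(u₀) = c`.  What is added here is the
**`π₁`-triviality** (`IsHoledDiscMorseFunction.mapOfEq_boundaryMirror₄_eq`): the boundary
`∂Y = {q(u) + z² + w² = c}` is, by the coordinates `(u, z + i w)`, *homeomorphic to the spun
space* `{(u, v) ∈ D × ℂ | ‖v‖ = √(c - q(u))}` over the planar domain `D = {q ≤ c}`
(`IsHoledDiscMorseFunction.boundaryHomeomorphSpun`), the reflection becoming complex
conjugation of the fibre coordinate and `z₀` a point with vanishing fibre coordinate; and on a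
spun space the conjugation acts as the identity on `π₁` at such a point
(`Literature.AlgebraicTopology.FundamentalGroup.Spun.mapOfEq_conjCM_eq`, `SpunLoops.lean`:
every loop unwinds into the section `v = √(c - q(u))`, which the conjugation fixes).  Induced
maps on `π₁` are transported along the homeomorphism by
`Literature.Topology.FourManifolds.FundamentalGroup.mapOfEq_conj`.

Classically: `∂(♮ᵏ S¹ × B³) = #ᵏ S¹ × S²` and its free fundamental group is generated by loops in
the mirror of the reflection, on which the reflection is the identity (cf. Laudenbach–Poénaru,
Bull. SMF 100 (1972), §2, p. 342, diagram (5), where the analogous orientation-reversing `F`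
with `(F₁)_# = id` is taken on the `X_p` side).  Everything here is **proved**.

## References

* F. Laudenbach, V. Poénaru, *A note on 4-dimensional handlebodies*, Bull. Soc. Math. France
  100 (1972), 337–344, §2, p. 342. [LaudenbachPoenaruBSMF1972]
* A. Hatcher, *Algebraic Topology* (2002), §1.1. [HatcherAT2002]
* M. W. Hirsch, *Differential Topology*, GTM 33 (1976), Ch. 4 §4. [HirschDT1976]
-/

open scoped Manifold ContDiff Topology ComplexConjugate
open Set Function Complex
open Literature.AlgebraicTopology.FundamentalGroup

noncomputable section

namespace Literature.Topology.FourManifolds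

/-- Local notation: `𝔼 n` is the model Euclidean space `EuclideanSpace ℝ (Fin n)`. -/
local notation "𝔼 " n:arg => EuclideanSpace ℝ (Fin n)

open PlanarThickening SolidThickening

namespace IsHoledDiscMorseFunction

variable {g : ℕ} {q : 𝔼 2 → ℝ} {c : ℝ} (h : IsHoledDiscMorseFunction g q c)

/-! ### The boundary `{q + z² + w² = c}` as a spun space over the planar domain `{q ≤ c}` -/

/-- The planar domain `D = {q ≤ c} ⊂ ℝ²` (a disc with `g` holes). [folklore] -/
def dom (q : 𝔼 2 → ℝ) (c : ℝ) : Set (𝔼 2) := {u | q u ≤ c}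

/-- The spinning radius `r(u) = √(c - q(u))` on the planar domain. [folklore] -/
def rad (q : 𝔼 2 → ℝ) (c : ℝ) (u : dom q c) : ℝ := Real.sqrt (c - q u.1)

omit h in
/-- `r ≥ 0`. [folklore] -/
theorem rad_nonneg (u : dom q c) : 0 ≤ rad q c u := Real.sqrt_nonneg _

omit h in
/-- `r(u)² = c - q(u)` on the domain. [folklore] -/
theorem rad_sq (u : dom q c) : rad q c u ^ 2 = c - q u.1 :=
  Real.sq_sqrt (sub_nonneg.2 u.2)

include h in
/-- `r` is continuous (for Morse, hence continuous, `q`). [folklore] -/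
theorem continuous_rad : Continuous (rad q c) :=
  Real.continuous_sqrt.comp (continuous_const.sub (h.continuous.comp continuous_subtype_val))

/-- The value of `G = q + z² + w²` at a boundary point is `c`. [folklore] -/
theorem apply_incl_eq (z : (𝓡∂ 4).boundary h.FourThickening) :
    thicken₄ (thicken q) (RegularSublevel.incl h.isRegularLevel₄ z.1) = c :=
  (RegularSublevel.mem_boundary_iff h.isRegularLevel₄ z.1).1 z.2

/-- The level equation at a boundary point: `q(x, y) + z² + w² = c`. [folklore] -/
theorem level_eq (z : (𝓡∂ 4).boundary h.FourThickening) :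
    q (proj (proj₃ (RegularSublevel.incl h.isRegularLevel₄ z.1))) +
      (RegularSublevel.incl h.isRegularLevel₄ z.1) 2 ^ 2 +
      (RegularSublevel.incl h.isRegularLevel₄ z.1) 3 ^ 2 = c := by
  have := h.apply_incl_eq z
  rw [thicken₄_apply, thicken_apply, proj₃_apply_two] at this
  exact this

/-- The planar coordinate `u = (x, y)` of a boundary point lies in the domain `{q ≤ c}`.
[folklore] -/
theorem proj_proj₃_incl_mem (z : (𝓡∂ 4).boundary h.FourThickening) :
    proj (proj₃ (RegularSublevel.incl h.isRegularLevel₄ z.1)) ∈ dom q c := by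
  show q _ ≤ c
  have := h.level_eq z
  nlinarith [sq_nonneg ((RegularSublevel.incl h.isRegularLevel₄ z.1) 2),
    sq_nonneg ((RegularSublevel.incl h.isRegularLevel₄ z.1) 3)]

/-- **The boundary as a spun space, forward map**: `(x, y, z, w) ↦ ((x, y), z + i w)`.
[folklore] -/
def toSpun (z : (𝓡∂ 4).boundary h.FourThickening) : Spun (rad q c) :=
  Spun.mk ⟨proj (proj₃ (RegularSublevel.incl h.isRegularLevel₄ z.1)), h.proj_proj₃_incl_mem z⟩
    (((RegularSublevel.incl h.isRegularLevel₄ z.1) 2 : ℂ) +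
      ((RegularSublevel.incl h.isRegularLevel₄ z.1) 3 : ℂ) * Complex.I) (by
    rw [norm_add_mul_I, rad]
    congr 1
    have := h.level_eq z
    show _ = c - q (proj (proj₃ (RegularSublevel.incl h.isRegularLevel₄ z.1)))
    linarith)

/-- The point of `ℝ⁴` with coordinates `(u, Re v, Im v)`. [folklore] -/
def spunPoint (p : Spun (rad q c)) : 𝔼 4 :=
  WithLp.toLp 2 ![(Spun.proj p).1 0, (Spun.proj p).1 1, (Spun.fib p).re, (Spun.fib p).im]

omit h in
/-- Coordinates of `spunPoint`. [folklore] -/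
@[simp] theorem spunPoint_apply_zero (p : Spun (rad q c)) : spunPoint p 0 = (Spun.proj p).1 0 := rfl

omit h in
/-- Coordinates of `spunPoint`. [folklore] -/
@[simp] theorem spunPoint_apply_one (p : Spun (rad q c)) : spunPoint p 1 = (Spun.proj p).1 1 := rfl

omit h in
/-- Coordinates of `spunPoint`. [folklore] -/
@[simp] theorem spunPoint_apply_two (p : Spun (rad q c)) : spunPoint p 2 = (Spun.fib p).re := rfl

omit h in
/-- Coordinates of `spunPoint`. [folklore] -/
@[simp] theorem spunPoint_apply_three (p : Spun (rad q c)) : spunPoint p 3 = (Spun.fib p).im := rfl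

omit h in
/-- The planar coordinate of `spunPoint p` is `pr₁ p`. [folklore] -/
theorem proj_proj₃_spunPoint (p : Spun (rad q c)) : proj (proj₃ (spunPoint p)) = (Spun.proj p).1 := by
  ext i; fin_cases i <;> rfl

omit h in
/-- `G(spunPoint p) = c`: the point lies on the level hypersurface. [folklore] -/
theorem thicken₄_thicken_spunPoint (p : Spun (rad q c)) : thicken₄ (thicken q) (spunPoint p) = c := by
  rw [thicken₄_apply, thicken_apply, proj_proj₃_spunPoint, proj₃_apply_two, spunPoint_apply_two,
    spunPoint_apply_three]
  have h1 : (Spun.fib p).re ^ 2 + (Spun.fib p).im ^ 2 = ‖Spun.fib p‖ ^ 2 := by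
    rw [Complex.sq_norm, Complex.normSq_apply]; ring
  have h2 : ‖Spun.fib p‖ = rad q c (Spun.proj p) := Spun.norm_fib p
  have h3 := rad_sq (Spun.proj p)
  have h2' : ‖Spun.fib p‖ ^ 2 = rad q c (Spun.proj p) ^ 2 := by rw [h2]
  linarith [h1, h2', h3]

/-- **The boundary as a spun space, inverse map**: `((x, y), v) ↦ (x, y, Re v, Im v)`.
[folklore] -/
def ofSpun (p : Spun (rad q c)) : (𝓡∂ 4).boundary h.FourThickening :=
  ⟨RegularSublevel.mk h.isRegularLevel₄ (spunPoint p) (thicken₄_thicken_spunPoint p).le, by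
    rw [RegularSublevel.mem_boundary_iff]
    exact thicken₄_thicken_spunPoint p⟩

/-- `incl (ofSpun p) = spunPoint p` (definitional). [folklore] -/
@[simp] theorem incl_ofSpun (p : Spun (rad q c)) :
    RegularSublevel.incl h.isRegularLevel₄ (h.ofSpun p).1 = spunPoint p := rfl

/-- `toSpun` is continuous. [folklore] -/
theorem continuous_toSpun : Continuous h.toSpun := by
  have hincl : Continuous fun z : (𝓡∂ 4).boundary h.FourThickening =>
      RegularSublevel.incl h.isRegularLevel₄ z.1 :=
    (RegularSublevel.contMDiff_incl h.isRegularLevel₄).continuous.comp continuous_subtype_val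
  refine Continuous.subtype_mk (Continuous.prodMk ?_ ?_) _
  · exact Continuous.subtype_mk (proj.continuous.comp (proj₃.continuous.comp hincl)) _
  · exact ((continuous_ofReal.comp ((EuclideanSpace.proj (2 : Fin 4)).continuous.comp hincl)).add
      ((continuous_ofReal.comp ((EuclideanSpace.proj (3 : Fin 4)).continuous.comp hincl)).mul
        continuous_const))

/-- `ofSpun` is continuous. [folklore] -/
theorem continuous_ofSpun : Continuous h.ofSpun := by
  have hsp : Continuous (spunPoint (q := q) (c := c)) := by
    have h0 : Continuous fun p : Spun (rad q c) => (Spun.proj p).1 0 :=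
      (EuclideanSpace.proj (0 : Fin 2)).continuous.comp
        (continuous_subtype_val.comp Spun.continuous_proj)
    have h1 : Continuous fun p : Spun (rad q c) => (Spun.proj p).1 1 :=
      (EuclideanSpace.proj (1 : Fin 2)).continuous.comp
        (continuous_subtype_val.comp Spun.continuous_proj)
    have h2 : Continuous fun p : Spun (rad q c) => (Spun.fib p).re :=
      continuous_re.comp Spun.continuous_fib
    have h3 : Continuous fun p : Spun (rad q c) => (Spun.fib p).im :=
      continuous_im.comp Spun.continuous_fib
    refine (PiLp.continuous_toLp (p := 2) (β := fun _ : Fin 4 => ℝ)).comp ?_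
    refine continuous_pi fun i => ?_
    fin_cases i
    · simpa using h0
    · simpa using h1
    · simpa using h2
    · simpa using h3
  refine Continuous.subtype_mk ?_ _
  exact Continuous.subtype_mk hsp _

/-- **The boundary `{q + z² + w² = c}` is homeomorphic to the spun space of the planar domain
`{q ≤ c}` with radius `√(c - q)`**, by `(x, y, z, w) ↦ ((x, y), z + i w)`. [folklore] -/
def boundaryHomeomorphSpun : (𝓡∂ 4).boundary h.FourThickening ≃ₜ Spun (rad q c) where
  toFun := h.toSpun
  invFun := h.ofSpun
  left_inv z := by
    apply Subtype.ext
    apply RegularSublevel.injective_incl h.isRegularLevel₄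
    rw [incl_ofSpun]
    ext i
    fin_cases i
    · rfl
    · rfl
    · show (((RegularSublevel.incl h.isRegularLevel₄ z.1 2 : ℝ) : ℂ) +
        ((RegularSublevel.incl h.isRegularLevel₄ z.1 3 : ℝ) : ℂ) * Complex.I).re = _
      simp
    · show (((RegularSublevel.incl h.isRegularLevel₄ z.1 2 : ℝ) : ℂ) +
        ((RegularSublevel.incl h.isRegularLevel₄ z.1 3 : ℝ) : ℂ) * Complex.I).im = _
      simp
  right_inv p := by
    refine Spun.ext ?_ ?_
    · apply Subtype.ext
      show proj (proj₃ (RegularSublevel.incl h.isRegularLevel₄ (h.ofSpun p).1)) = (Spun.proj p).1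
      rw [incl_ofSpun, proj_proj₃_spunPoint]
    · show ((RegularSublevel.incl h.isRegularLevel₄ (h.ofSpun p).1 2 : ℝ) : ℂ) +
        ((RegularSublevel.incl h.isRegularLevel₄ (h.ofSpun p).1 3 : ℝ) : ℂ) * Complex.I = Spun.fib p
      rw [incl_ofSpun, spunPoint_apply_two, spunPoint_apply_three, re_add_im]
  continuous_toFun := h.continuous_toSpun
  continuous_invFun := h.continuous_ofSpun

/-- The homeomorphism is `toSpun` as a function. [folklore] -/
@[simp] theorem boundaryHomeomorphSpun_apply (z : (𝓡∂ 4).boundary h.FourThickening) :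
    h.boundaryHomeomorphSpun z = h.toSpun z := rfl

/-- **Under the homeomorphism the mirror symmetry `w ↦ -w` becomes complex conjugation of the
fibre coordinate.** [folklore] -/
theorem toSpun_boundaryMirror₄ (z : (𝓡∂ 4).boundary h.FourThickening) :
    h.toSpun (RegularSublevel.boundaryMirror₄ h.isRegularLevel₄
        (thicken₄_thicken_reflectFourth (q := q)) z) = Spun.conjMap (h.toSpun z) := by
  have hc := RegularSublevel.incl_boundaryMirror₄ h.isRegularLevel₄
    (thicken₄_thicken_reflectFourth (q := q)) z
  refine Spun.ext ?_ ?_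
  · apply Subtype.ext
    show proj (proj₃ (RegularSublevel.incl h.isRegularLevel₄ (RegularSublevel.boundaryMirror₄
      h.isRegularLevel₄ _ z).1)) = proj (proj₃ (RegularSublevel.incl h.isRegularLevel₄ z.1))
    rw [hc]
    ext i; fin_cases i
    · show reflectFourth _ 0 = _
      rw [reflectFourth_apply, reflectFourthCLE_apply_coord]; rfl
    · show reflectFourth _ 1 = _
      rw [reflectFourth_apply, reflectFourthCLE_apply_coord]; rfl
  · show ((RegularSublevel.incl h.isRegularLevel₄ (RegularSublevel.boundaryMirror₄
        h.isRegularLevel₄ _ z).1 2 : ℝ) : ℂ) +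
      ((RegularSublevel.incl h.isRegularLevel₄ (RegularSublevel.boundaryMirror₄
        h.isRegularLevel₄ _ z).1 3 : ℝ) : ℂ) * Complex.I =
      conj (((RegularSublevel.incl h.isRegularLevel₄ z.1 2 : ℝ) : ℂ) +
        ((RegularSublevel.incl h.isRegularLevel₄ z.1 3 : ℝ) : ℂ) * Complex.I)
    rw [hc, reflectFourth_apply, reflectFourthCLE_apply_coord, reflectFourthCLE_apply_coord]
    simp only [Fin.isValue, show (2 : Fin 4) ≠ 3 by decide, ↓reduceIte]
    apply Complex.ext <;> simp

/-- The base point `z₀ = (u₀, 0, 0)` has vanishing fibre coordinate in the spun space.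
[folklore] -/
theorem fib_toSpun_basePoint₄ {u₀ : 𝔼 2} (hu₀ : q u₀ = c) :
    Spun.fib (h.toSpun (h.basePoint₄ hu₀)) = 0 := by
  show ((RegularSublevel.incl h.isRegularLevel₄ (h.basePoint₄ hu₀).1 2 : ℝ) : ℂ) +
      ((RegularSublevel.incl h.isRegularLevel₄ (h.basePoint₄ hu₀).1 3 : ℝ) : ℂ) * Complex.I = 0
  rw [incl_basePoint₄]
  simp

/-- **The mirror symmetry acts as the identity on `π₁` of the boundary at the base point
`z₀ = (u₀, 0, 0)`**: transported along `boundaryHomeomorphSpun` it is the conjugation of a spun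
space at a point with vanishing fibre coordinate
(`Literature.AlgebraicTopology.FundamentalGroup.Spun.mapOfEq_conjCM_eq`), and induced maps on
`π₁` are natural under conjugation by homeomorphisms (`FundamentalGroup.mapOfEq_conj`).
Hatcher (2002), §1.1. [folklore] -/
theorem mapOfEq_boundaryMirror₄_eq {u₀ : 𝔼 2} (hu₀ : q u₀ = c)
    (a : FundamentalGroup ((𝓡∂ 4).boundary h.FourThickening) (h.basePoint₄ hu₀)) :
    FundamentalGroup.mapOfEq
      (⟨RegularSublevel.boundaryMirror₄ h.isRegularLevel₄ (thicken₄_thicken_reflectFourth (q := q)),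
        (RegularSublevel.boundaryMirror₄ h.isRegularLevel₄
          (thicken₄_thicken_reflectFourth (q := q))).continuous⟩ :
        C((𝓡∂ 4).boundary h.FourThickening, (𝓡∂ 4).boundary h.FourThickening))
      (h.boundaryMirror₄_basePoint₄ hu₀) a = a := by
  set e := h.boundaryHomeomorphSpun with he
  have h0 : Spun.fib (e (h.basePoint₄ hu₀)) = 0 := h.fib_toSpun_basePoint₄ hu₀
  have key := FundamentalGroup.mapOfEq_conj e (rfl : e (h.basePoint₄ hu₀) = e (h.basePoint₄ hu₀))
    (⟨RegularSublevel.boundaryMirror₄ h.isRegularLevel₄ (thicken₄_thicken_reflectFourth (q := q)),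
      (RegularSublevel.boundaryMirror₄ h.isRegularLevel₄
        (thicken₄_thicken_reflectFourth (q := q))).continuous⟩)
    (Spun.conjCM (r := rad q c)) (h.boundaryMirror₄_basePoint₄ hu₀)
    (Spun.conjMap_eq_self_of_fib_eq_zero h0) (fun z => h.toSpun_boundaryMirror₄ z) a
  rw [Spun.mapOfEq_conjCM_eq h.continuous_rad rad_nonneg h0] at key
  exact ((Homeomorph.fundamentalGroupCongr e rfl).injective key).symm

end IsHoledDiscMorseFunction

/-- **SYMMᴹ holds (universe `0`): discharge of
`Literature.Topology.FourManifolds.exists_oneHandlebody_diffeoExtends_isOrientationReversing.{0}`.**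
For every `k`, the `1`-handlebody `Y = {q(x, y) + z² + w² ≤ c} ⊂ ℝ⁴` (one `0`-handle, `k`
`1`-handles, compact, connected, orientable; `ThickenedHandlebodyFour.lean`), its boundary datum,
the restriction `ρ₀` of the reflection `w ↦ -w` and the base point `z₀ = (u₀, 0, 0)` witness the
fact: `ρ₀` extends over `Y`, reverses every smooth orientation of `∂Y`, fixes `z₀`
(`OneHandlebodyMirrorFour.lean`) and induces the identity of `π₁(∂Y, z₀)`
(`IsHoledDiscMorseFunction.mapOfEq_boundaryMirror₄_eq`).  With NORM and UNIQ₄ this gives the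
named fact `exists_diffeoExtends_isOrientationReversing` (h₃) in universe `0`
(`exists_diffeoExtends_isOrientationReversing_of_model`).  Cf. Laudenbach–Poénaru (1972), §2,
p. 342, diagram (5). [folklore] -/
theorem exists_oneHandlebody_diffeoExtends_isOrientationReversing_zero :
    exists_oneHandlebody_diffeoExtends_isOrientationReversing.{0} := by
  intro k
  obtain ⟨q, c, h⟩ := exists_isHoledDiscMorseFunction k
  obtain ⟨u₀, hu₀⟩ := h.exists_apply_eq
  obtain ⟨hext, hrev, -⟩ := h.fourThickening_symm
  exact ⟨h.FourThickening, inferInstance, inferInstance, inferInstance, h.compactSpace_fourThickening,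
    h.connectedSpace_fourThickening, inferInstance, inferInstance,
    RegularSublevel.boundaryData h.isRegularLevel₄,
    RegularSublevel.boundaryMirror₄ h.isRegularLevel₄
      (IsHoledDiscMorseFunction.thicken₄_thicken_reflectFourth (q := q)),
    h.hasHandleDecomposition_fourThickening, h.isOrientable_fourThickening, hext, hrev,
    h.basePoint₄ hu₀, h.boundaryMirror₄_basePoint₄ hu₀, fun a => h.mapOfEq_boundaryMirror₄_eq hu₀ a⟩

/-- **h₃ in universe `0` from NORM and UNIQ₄ alone**: with SYMMᴹ discharged, the named fact
`Literature.Topology.FourManifolds.exists_diffeoExtends_isOrientationReversing.{0}` (an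
orientation-reversing, `π₁`-trivial, extendable diffeomorphism of the boundary of every compact
connected orientable `4`-dimensional `1`-handlebody) follows from the normal form NORM and the
classification UNIQ₄ (`exists_diffeoExtends_isOrientationReversing_of_model`). [folklore] -/
theorem exists_diffeoExtends_isOrientationReversing_zero_of_norm_of_uniq
    (hN : exists_hasHandleDecomposition_handleCount_one.{0})
    (hU : nonempty_diffeomorph_of_hasHandleDecomposition_handleCount_one.{0}) :
    exists_diffeoExtends_isOrientationReversing.{0} :=
  exists_diffeoExtends_isOrientationReversing_of_model hN hU
    exists_oneHandlebody_diffeoExtends_isOrientationReversing_zero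

/-- **The Laudenbach–Poénaru fact in universe `0` from four named facts**: NORM, UNIQ₄, LEMMA2ᴹ
and THMAᴹ (SYMMᴹ being discharged above). [cite: LaudenbachPoenaruBSMF1972, §2, pp. 339–342] -/
theorem exists_diffeomorph_comp_incl_eq_zero_of_model
    (hN : exists_hasHandleDecomposition_handleCount_one.{0})
    (hU : nonempty_diffeomorph_of_hasHandleDecomposition_handleCount_one.{0})
    (hL : exists_oneHandlebody_laudenbachPoenaru_exists_diffeoExtends_mapOfEq_eq.{0})
    (hT : exists_oneHandlebody_laudenbachPoenaru_diffeoExtends_of_isOrientationPreserving.{0}) :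
    exists_diffeomorph_comp_incl_eq.{0} :=
  exists_diffeomorph_comp_incl_eq_of_model hN hU hL hT
    exists_oneHandlebody_diffeoExtends_isOrientationReversing_zero

end Literature.Topology.FourManifolds
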